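import Mathlib
import Summits.Ventures.PercRepro2.LocRows
import Summits.Ventures.PercRepro2.SwRow
import Summits.Ventures.PercRepro2.SwOut
import Summits.Ventures.PercRepro2.SwAllRow
import Summits.Ventures.PercRepro2.SwOutAll
import Summits.Ventures.PercRepro2.SwOutArmFlip
import Summits.Ventures.PercRepro2.SwOutArmThm
import Summits.Ventures.PercRepro2.SwOutCoreDefs
import Summits.Ventures.PercRepro2.SwOutBigBlockDefs
import Summits.Ventures.PercRepro2.SwOutMixedBaseDefs
import Summits.Ventures.PercRepro2.SwOutMixedBaseClasses
import Summits.Ventures.PercRepro2.SwOutMixedBaseHull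
import Summits.Ventures.PercRepro2.SwOutMixedBaseDual
import Summits.Ventures.PercRepro2.SwOutMixedCore
import Summits.Ventures.PercRepro2.SwOutMixedCoreEdgeMap
import Summits.Ventures.PercRepro2.SwOutMixedCoreClass

/-!
# (G1) as an equivalence: the class points of the raw cube are the non-leaking points (blind cell
PercRepro2, night-4 g18, 2026-08-27; proofs/NIGHT4-G18.md §6)

`not_hull_subset_of_leakB` is the blue side of `not_hull_subset_of_leakR` by duality (the blue
colouring of a realisation is the realisation of the dual base at the flipped point, and the hull
is colour-symmetric), and `mem_outClass_iff`: under the non-degeneracy of NIGHT4-G17.md §4⁗ (an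
outside edge and a dead edge at `p`, the outside neighbours of `p` and the boundary neighbours of
the h-piece outside the region) and with the base in the outside class, the realisation of a
point is in `outClass Us h ξ` IFF the point is non-leaking — the class ∩ cube = `¬ Leak'`, the
identification (G1) of NIGHT4-G17.md §4⁗ in both directions.
-/

namespace Summit.Ventures.PercRepro2

namespace BigBlock

open Hull LocRows

open scoped Classical

variable {V : Type*} {E : Type*}

section ClassIff

variable {ι κ : Type*} {ends : E → Sym2 V} {σ : Config E} {h u p : V} {U : ι → Set V} {Ah : Set V}
  {F : κ → Set V} (hb : MixedBase ends σ h u p U Ah F)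
include hb

/-- **(G1 ⇒), blue side**: at a blue-side leaking point the hull of `h` leaves the region. -/
theorem MixedBase.not_hull_subset_of_leakB [Fintype E] [DecidableEq E]
    (hup : ∃ e, ends e = s(u, p)) {Us : Set V}
    (hext : ∃ e, e ∈ clsExt ends u p Ah)
    (hext_out : ∀ e x, ends e = s(p, x) → x ≠ u → x ∉ Ah → x ∉ Us)
    (hdead : ∃ e y, ends e = s(p, y) ∧ y ∈ Ah)
    (hbdry : ∀ y ∈ Ah, ∃ e z, ends e = s(y, z) ∧ z ≠ h ∧ z ≠ u ∧ z ≠ p ∧ z ∉ armsAll U Ah F ∧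
      z ∉ Us)
    {q : Pt ι κ} (hq : LeakB q) :
    ¬ (hull ends (mixedReal ends u p U Ah F σ q) h ⊆ Us) := by
  have key := hb.dual.not_hull_subset_of_leakR hup hext hext_out hdead hbdry hq
  rw [← hb.blue_mixedReal, hull_blue] at key
  exact key

/-- **(G1) as an equivalence**: with the base in the outside class of the region, the realisation
of a point of the raw cube is in the outside class iff the point is non-leaking. -/
theorem MixedBase.mem_outClass_iff [Fintype E] [DecidableEq E]
    (hup : ∃ e, ends e = s(u, p)) {Us : Set V}
    (hUs : {h} ∪ {u} ∪ {p} ∪ armsAll U Ah F ⊆ Us) {ξ : Config E}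
    (hσ : ∀ e, e ∉ touches ends Us → σ e = ξ e)
    (hext : ∃ e, e ∈ clsExt ends u p Ah)
    (hext_out : ∀ e x, ends e = s(p, x) → x ≠ u → x ∉ Ah → x ∉ Us)
    (hdead : ∃ e y, ends e = s(p, y) ∧ y ∈ Ah)
    (hbdry : ∀ y ∈ Ah, ∃ e z, ends e = s(y, z) ∧ z ≠ h ∧ z ≠ u ∧ z ≠ p ∧ z ∉ armsAll U Ah F ∧
      z ∉ Us)
    (q : Pt ι κ) :
    mixedReal ends u p U Ah F σ q ∈ outClass ends Us h ξ ↔ ¬ Leak' q := by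
  constructor
  · intro hmem
    rw [leak'_iff, not_or]
    simp only [outClass, Finset.mem_filter, Finset.mem_univ, true_and] at hmem
    exact ⟨fun hR => hb.not_hull_subset_of_leakR hup hext hext_out hdead hbdry hR hmem.2,
      fun hB => hb.not_hull_subset_of_leakB hup hext hext_out hdead hbdry hB hmem.2⟩
  · intro hq
    rw [leak'_iff, not_or] at hq
    exact hb.mixedReal_mem_outClass hup hUs hσ hq.1 hq.2

end ClassIff

end BigBlock

end Summit.Ventures.PercRepro2
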